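import Summits.QuantumFields.YangMills.Theorems.LuscherReductionTwistedTraceScalingBOStiffFlatDefs
import Summits.QuantumFields.YangMills.Theorems.LuscherReductionTwistedTraceScalingBOStiffCentralFloor
import Summits.QuantumFields.YangMills.Theorems.LuscherReductionTwistedTraceScalingBOStiffMehlerExit
import Summits.QuantumFields.YangMills.Theorems.LuscherReductionTwistedTraceScalingBOStiffQuasimodeModel
import Summits.QuantumFields.YangMills.Theorems.LuscherReductionTwistedTraceScalingBOCentralTube
import Summits.QuantumFields.YangMills.Theorems.LuscherReductionTwistedTraceScalingToronZeroMode
import HarnessLib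

/-!
# (B-ST) the central objects IN FLAT COORDINATES: `cS`, `cΘ`, `cD`, `cK` pulled back along `flatMap β`, and the sizes of the Mehler data
# (lane A of S-BASE, crux `TwistedTraceScaling` stmt-QuantumFields-20203, C4-CORE, the (B-ST) pen; `pub/ym-fleet/ym-luscher-20007-p1/HANDOFF-g22.md` §PLAN TO CLOSE hflat (3))

With the dictionary of ✓`…BOStiffFlatCoords` (`v = flatVec β (y,z) = Σγ_iy_iE_i + z`, `q_β(v) = πΣy²`, `⟪v,(β/2)Hv⟫ = Σã_iy_i²`, `P_Γv = z`, `‖v − P_Γv‖² = Σγ²y²`):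
* §1 sizes: `stiffCoef_le` (`c_i ≤ 49β`: ✓`stiffGaussExp_le_mul_norm_sq` at `E_i`), `eigVal_ge` (`α_i ≥ (β/2)·gap`, `gap = 2 − 2cos(2π/L)`, ✓`stiff_coercive_of_mem_orthogonal`, `L ≥ 2`),
  `stiffCoef_ge` (`c_i ≥ β√gap`), ★ `flatRatio_le` (`b̃_i/(ã_i+b̃_i+π) ≤ 1/(1+√gap) < 1`, β-FREE), `flatScale_sq_le/ge` (`π/(49β) ≤ γ_i² ≤ π/(β√gap)`);
* §2 the support: ★ `flatMap_mem_cS_iff` — `flatMap β (y,z) ∈ cS L β ↔ Σ(γ_iy_i)² + ‖z‖² ≤ r(β)²` (`r ≤ 1/40 < 1/4` makes the cap automatic), i.e. `flatMap⁻¹(cS)` IS the weighted ball of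
  ✓`…BOStiffFlatModel`;
* §3 the objects: ★ `cΘ_flatMap` (`cΘ(flatMap(y,z)) = e^{−‖z‖²/s²}·hR 0 y / vacCoef` on the ball, `s = powScale 1 β`), ★ `cD_flatMap` (`cD(flatMap(y,z)) = (N̄(s)/vacCoef²)·hR 0 y²·e^{−‖z‖²/s²}`,
  all `(y,z)`), ★★ `cK_flatMap` — the EXACT identity `cK(flatMap p, flatMap q) = mehlerKernel flatA flatB p.1 q.1 · e(flatMap p)·e(flatMap q)` with the action-to-Hessian factor
  `e(x) = exp(⟪x̂,(β/2)Hx̂⟫ − (β/2)S(orthoTube 1 x))`, and ★★ `kernel_flatMap_two_sided`: on the ball, if `|(β/2)S(oT 1 ·) − ⟪·,(β/2)H·⟫| ≤ η` (✓`eventually_action_hessian_cS`) then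
  `e^{−2η}·G/vacCoef² ≤ (cΘ·cK·cΘ)∘flatMap² ≤ e^{2η}·G/vacCoef²`, `G = hR0·K·hR0'·e^{−‖z‖²/s²}e^{−‖z'‖²/s²}` (the kernel of ✓`flat_model_selfNormalised`).
HONEST FRAMING: bookkeeping for a stub of a child of the CONDITIONAL route R2b1; (B-ST) OPEN; C4-CORE OPEN; not infinite volume, not a gap, not Clay.
(Build touch 2026-08-30, hand A w1 g2: docstring-only re-land to rebuild the missing hub olean of this module — declarations byte-identical to ✓p751379.)
-/

set_option autoImplicit false

noncomputable section

open scoped BigOperators RealInnerProductSpace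
open Literature.MathematicalPhysics.QuantumFieldTheory Literature.MathematicalPhysics.QuantumLattice

namespace Summit.QuantumFields.YangMills.Theorems.FemtoTransferGap.TwoLattice.ConstTube

open Summit.QuantumFields.YangMills.Theorems.FemtoTransferGap
open TwoLattice TwoLattice.Stiff TwoLattice.Cov TwoLattice.GnChart TwoLattice.Toron
open Summit.QuantumFields.YangMills.Theorems.FemtoTransferGap.Mehler (hR mehlerKernel hR_zero_apply)
open Literature.Analysis.SegalBargmann (vacCoef vacCoef_pos)

variable {L : ℕ} [NeZero L]

/-! ## §1 Sizes of the Mehler data -/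

/-- `q_β(E_k) = c_k`. [folklore] -/
theorem stiffGaussExp_eigVec (β : ℝ) (k : Fin (Fintype.card (Edge 3 L × Fin 3))) : stiffGaussExp L (β / 2) β (eigVec L β k) = stiffCoef L β k := by
  classical
  unfold stiffGaussExp
  change ∑ j, Real.sqrt (eigVal L β j ^ 2 + 2 * eigVal L β j * β) * ⟪eigVec L β j, eigVec L β k⟫ ^ 2 = stiffCoef L β k
  have horth := eigVec_orthonormal (L := L) β
  rw [orthonormal_iff_ite] at horth
  simp_rw [horth]
  simp [Finset.sum_ite_eq', stiffCoef]

/-- ★ `c_k ≤ 49β` (`β ≥ 0`). [folklore] -/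
theorem stiffCoef_le {β : ℝ} (hβ : 0 ≤ β) (k : Fin (Fintype.card (Edge 3 L × Fin 3))) : stiffCoef L β k ≤ 49 * β := by
  have h := stiffGaussExp_le_mul_norm_sq (L := L) (t := β / 2) (by linarith) hβ (eigVec L β k)
  rw [stiffGaussExp_eigVec, (eigVec_orthonormal (L := L) β).1 k] at h
  linarith

/-- ★ `α_k ≥ (β/2)·(2 − 2cos(2π/L))` on stiff modes (`L ≥ 2`, `β ≥ 0`). [cite: Luscher1983, §3] -/
theorem eigVal_ge (hL : 2 ≤ L) {β : ℝ} (hβ : 0 ≤ β) (k : StiffIdx L β) : β / 2 * (2 - 2 * Real.cos (2 * Real.pi / L)) ≤ eigVal L β k.1 := by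
  have hmem := eigVec_mem_stiffSpace (L := L) β k.2
  rw [stiffSpace_eq_orthogonal] at hmem
  have hco := stiff_coercive_of_mem_orthogonal (L := L) hL hmem
  have h := inner_hessian_eigVec (L := L) β k.1
  rw [LinearMap.smul_apply, real_inner_smul_right, inner_stiffHessian, ← covCurl_one] at h
  rw [(eigVec_orthonormal (L := L) β).1 k.1] at hco
  have hβ2 : 0 ≤ β / 2 := by linarith
  nlinarith [mul_le_mul_of_nonneg_left hco hβ2]

/-- ★ `c_k ≥ β·√(2 − 2cos(2π/L))` on stiff modes (`L ≥ 2`, `β ≥ 0`). [folklore] -/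
theorem stiffCoef_ge (hL : 2 ≤ L) {β : ℝ} (hβ : 0 ≤ β) (k : StiffIdx L β) : β * Real.sqrt (2 - 2 * Real.cos (2 * Real.pi / L)) ≤ stiffCoef L β k.1 := by
  set gap := 2 - 2 * Real.cos (2 * Real.pi / L) with hgap
  have hgap0 : 0 ≤ gap := by have := Real.cos_le_one (2 * Real.pi / L); linarith
  have hα := eigVal_ge (L := L) hL hβ k
  have hα0 : 0 ≤ eigVal L β k.1 := eigVal_nonneg hβ _
  have h2 : (β * Real.sqrt gap) ^ 2 ≤ eigVal L β k.1 ^ 2 + 2 * eigVal L β k.1 * β := by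
    rw [mul_pow, Real.sq_sqrt hgap0]; nlinarith [mul_le_mul_of_nonneg_left hα hβ]
  unfold stiffCoef
  rw [← Real.sqrt_sq (by positivity : 0 ≤ β * Real.sqrt gap)]
  exact Real.sqrt_le_sqrt h2

/-- ★ **The contraction ratio is bounded by a β-free number `< 1`**: `b̃_k/(ã_k+b̃_k+π) ≤ 1/(1 + √(2 − 2cos(2π/L)))` (`L ≥ 2`, `β > 0`). [folklore] -/
theorem flatRatio_le (hL : 2 ≤ L) {β : ℝ} (hβ : 0 < β) (k : StiffIdx L β) :
    flatB L β k / (flatA L β k + flatB L β k + Real.pi) ≤ 1 / (1 + Real.sqrt (2 - 2 * Real.cos (2 * Real.pi / L))) := by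
  rw [flatRatio_eq (L := L) hβ k]
  have hc := stiffCoef_ge (L := L) hL hβ.le k
  have hα : 0 ≤ eigVal L β k.1 := eigVal_nonneg hβ.le _
  have hs0 : 0 ≤ Real.sqrt (2 - 2 * Real.cos (2 * Real.pi / L)) := Real.sqrt_nonneg _
  rw [div_le_div_iff₀ (by have := stiffCoef_pos (L := L) hβ k; positivity) (by positivity)]
  nlinarith

/-- `γ_k² ≤ π/(β√gap)` and `π/(49β) ≤ γ_k²` (`L ≥ 2`, `β > 0`, `gap > 0`). [folklore] -/
theorem flatScale_sq_bounds (hL : 2 ≤ L) {β : ℝ} (hβ : 0 < β) (hgap : 0 < 2 - 2 * Real.cos (2 * Real.pi / L)) (k : StiffIdx L β) :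
    Real.pi / (49 * β) ≤ flatScale L β k ^ 2 ∧ flatScale L β k ^ 2 ≤ Real.pi / (β * Real.sqrt (2 - 2 * Real.cos (2 * Real.pi / L))) := by
  obtain ⟨-, hγ2⟩ := flatScale_pos_sq (L := L) hβ k
  have hc := stiffCoef_pos (L := L) hβ k
  rw [hγ2]
  refine ⟨div_le_div_of_nonneg_left Real.pi_pos.le hc (stiffCoef_le hβ.le _), div_le_div_of_nonneg_left Real.pi_pos.le (by positivity) (stiffCoef_ge hL hβ.le k)⟩

omit [NeZero L] in
/-- ★ The β-free contraction bound is `< 1`: `0 ≤ 1/(1+√gap) < 1` (`L ≥ 2`). [folklore] -/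
theorem flatRho_lt_one (hL : 2 ≤ L) : 0 ≤ 1 / (1 + Real.sqrt (2 - 2 * Real.cos (2 * Real.pi / L))) ∧ 1 / (1 + Real.sqrt (2 - 2 * Real.cos (2 * Real.pi / L))) < 1 := by
  have hs : 0 < Real.sqrt (2 - 2 * Real.cos (2 * Real.pi / L)) := Real.sqrt_pos.2 (gap_pos L hL)
  refine ⟨by positivity, ?_⟩
  rw [div_lt_one (by positivity)]; linarith

/-- The number of stiff modes is at most the number of link components `3|E|` (β-free). [folklore] -/
theorem card_stiffIdx_le (β : ℝ) : Fintype.card (StiffIdx L β) ≤ Fintype.card (Edge 3 L × Fin 3) := by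
  classical
  unfold StiffIdx
  exact (Fintype.card_subtype_le _).trans (by rw [Fintype.card_fin])

/-- `Σ_k γ_k² ≤ 3|E|·π/(β√gap)` (`L ≥ 2`, `β > 0`). [folklore] -/
theorem sum_flatScale_sq_le (hL : 2 ≤ L) {β : ℝ} (hβ : 0 < β) :
    ∑ k : StiffIdx L β, flatScale L β k ^ 2 ≤ Fintype.card (Edge 3 L × Fin 3) * (Real.pi / (β * Real.sqrt (2 - 2 * Real.cos (2 * Real.pi / L)))) := by
  have hgap := gap_pos L hL
  calc ∑ k : StiffIdx L β, flatScale L β k ^ 2 ≤ ∑ _k : StiffIdx L β, Real.pi / (β * Real.sqrt (2 - 2 * Real.cos (2 * Real.pi / L))) :=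
        Finset.sum_le_sum fun k _ => (flatScale_sq_bounds hL hβ hgap k).2
    _ = Fintype.card (StiffIdx L β) * (Real.pi / (β * Real.sqrt (2 - 2 * Real.cos (2 * Real.pi / L)))) := by
        rw [Finset.sum_const, nsmul_eq_mul, Finset.card_univ]
    _ ≤ Fintype.card (Edge 3 L × Fin 3) * (Real.pi / (β * Real.sqrt (2 - 2 * Real.cos (2 * Real.pi / L)))) := by
        have hsq : 0 < Real.sqrt (2 - 2 * Real.cos (2 * Real.pi / L)) := Real.sqrt_pos.2 hgap
        exact mul_le_mul_of_nonneg_right (by exact_mod_cast card_stiffIdx_le (L := L) β) (by positivity)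

/-- ★ The box radius `R = r·√(49β/π)` dominates: `r ≤ γ_k·R` for every stiff mode (`r ≥ 0`, `β > 0`, `L ≥ 2`). [folklore] -/
theorem le_flatScale_mul (hL : 2 ≤ L) {β : ℝ} (hβ : 0 < β) {r : ℝ} (hr : 0 ≤ r) (k : StiffIdx L β) : r ≤ flatScale L β k * (r * Real.sqrt (49 * β / Real.pi)) := by
  obtain ⟨hγ, -⟩ := flatScale_pos_sq (L := L) hβ k
  have hlo := (flatScale_sq_bounds hL hβ (gap_pos L hL) k).1
  have h1 : 1 ≤ flatScale L β k * Real.sqrt (49 * β / Real.pi) := by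
    rw [← Real.sqrt_sq hγ.le, ← Real.sqrt_mul (sq_nonneg _), ← Real.sqrt_one]
    refine Real.sqrt_le_sqrt ?_
    rw [div_le_iff₀ (by positivity)] at hlo
    rw [mul_div_assoc', le_div_iff₀ Real.pi_pos]; linarith
  calc r = r * 1 := (mul_one r).symm
    _ ≤ r * (flatScale L β k * Real.sqrt (49 * β / Real.pi)) := mul_le_mul_of_nonneg_left h1 hr
    _ = flatScale L β k * (r * Real.sqrt (49 * β / Real.pi)) := by ring

/-! ## §2 The support in flat coordinates -/

/-- ★ **`flatMap⁻¹(cS)` is the weighted ball**: `flatMap β (y,z) ∈ cS L β ↔ Σ(γ_iy_i)² + ‖z‖² ≤ r(β)²`. [folklore] -/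
theorem flatMap_mem_cS_iff (β : ℝ) (p : (StiffIdx L β → ℝ) × gaugeModes L) :
    flatMap L β p ∈ cS L β ↔ (∑ i, (flatScale L β i * p.1 i) ^ 2) + ‖(p.2 : LinkSpace L)‖ ^ 2 ≤ (min (1 / 40) (powScale (1 / 2) β * btLog β)) ^ 2 := by
  set r := min (1 / 40) (powScale (1 / 2) β * btLog β) with hr
  have hr0 : 0 ≤ r := le_min (by norm_num) (mul_nonneg (powScale_pos _ _).le (zero_le_one.trans (one_le_btLog β)))
  rw [mem_cS_iff, linkEmbed_flatMap, ← norm_flatVec_sq]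
  constructor
  · rintro ⟨-, h⟩; exact pow_le_pow_left₀ (norm_nonneg _) h 2
  · intro h
    have hn : ‖flatVec L β p‖ ≤ r := (pow_le_pow_iff_left₀ (norm_nonneg _) hr0 two_ne_zero).1 h
    refine ⟨mem_capBalancedSet_of_norm_le (flatMap_mem_balancedSet β p) ?_, hn⟩
    rw [linkEmbed_flatMap]; exact (hn.trans (min_le_left _ _)).trans (by norm_num)

/-- ★ **`flatMap⁻¹(cS)` IS the weighted ball of ✓`…BOStiffFlatModel`** (`γ = flatScale β`, `r = r(β)`). [folklore] -/
theorem preimage_flatMap_cS (β : ℝ) :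
    flatMap L β ⁻¹' cS L β = {p : (StiffIdx L β → ℝ) × gaugeModes L | ∑ k, flatScale L β k ^ 2 * p.1 k ^ 2 + ‖p.2‖ ^ 2 ≤ (min (1 / 40) (powScale (1 / 2) β * btLog β)) ^ 2} := by
  ext p
  rw [Set.mem_preimage, flatMap_mem_cS_iff, Set.mem_setOf_eq]
  simp only [mul_pow, Submodule.coe_norm]

/-! ## §3 The objects in flat coordinates -/

/-- `e^{−q_β(flatVec p)} = hR 0 p.1 / vacCoef`. [folklore] -/
theorem exp_neg_stiffGaussExp_flatVec {β : ℝ} (hβ : 0 < β) (p : (StiffIdx L β → ℝ) × gaugeModes L) :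
    Real.exp (-(stiffGaussExp L (β / 2) β (flatVec L β p))) = hR 0 p.1 / vacCoef (StiffIdx L β) := by
  rw [stiffGaussExp_flatVec hβ, hR_zero_apply, mul_div_cancel_left₀ _ (vacCoef_pos).ne']

/-- ★ `cΘ(flatMap p) = e^{−‖z‖²/s²}·hR 0 y/vacCoef` on the ball (`s = powScale 1 β`). [folklore] -/
theorem cΘ_flatMap {β : ℝ} (hβ : 0 < β) {p : (StiffIdx L β → ℝ) × gaugeModes L} (hp : flatMap L β p ∈ cS L β) :
    cΘ L β (flatMap L β p) = Real.exp (-(‖(p.2 : LinkSpace L)‖ ^ 2 / powScale 1 β ^ 2)) * (hR 0 p.1 / vacCoef (StiffIdx L β)) := by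
  obtain ⟨h, -⟩ := cΘ_eq_on_cS (L := L) β hp
  rw [h, linkEmbed_flatMap, starProjection_gaugeModes_flatVec, exp_neg_stiffGaussExp_flatVec hβ]

/-- ★ `cD(flatMap p) = (N̄(s)/vacCoef²)·hR 0 y²·e^{−‖z‖²/s²}` for ALL `p` (`s = powScale 1 β`). [folklore] -/
theorem cD_flatMap {β : ℝ} (hβ : 0 < β) (p : (StiffIdx L β → ℝ) × gaugeModes L) :
    cD L β (flatMap L β p) = fpWeightBar L (powScale 1 β) / vacCoef (StiffIdx L β) ^ 2 * (hR 0 p.1 ^ 2 * Real.exp (-(‖(p.2 : LinkSpace L)‖ ^ 2 / powScale 1 β ^ 2))) := by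
  unfold cD
  rw [linkEmbed_flatMap, starProjection_gaugeModes_flatVec]
  have h2 : Real.exp (-(2 * stiffGaussExp L (β / 2) β (flatVec L β p))) = (hR 0 p.1 / vacCoef (StiffIdx L β)) ^ 2 := by
    rw [← exp_neg_stiffGaussExp_flatVec hβ, ← Real.exp_nat_mul]; congr 1; ring
  rw [h2]
  field_simp

/-- ★★ **`cK` in flat coordinates, exactly**: `cK(flatMap p, flatMap q) = mehlerKernel ã b̃ p.1 q.1 · e(flatMap p)·e(flatMap q)`,
`e(x) = exp(⟪x̂,(β/2)Hx̂⟫ − (β/2)S(orthoTube 1 x))`. [cite: Wipf2021, §8.5.1 (8.56)] -/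
theorem cK_flatMap (β : ℝ) (p q : (StiffIdx L β → ℝ) × gaugeModes L) :
    cK L β (flatMap L β p) (flatMap L β q) = mehlerKernel (flatA L β) (flatB L β) p.1 q.1 *
      (Real.exp (⟪flatVec L β p, ((β / 2) • stiffHessian L) (flatVec L β p)⟫ - β / 2 * wilsonAction su2Rep (orthoTube L 1 (flatMap L β p))) *
        Real.exp (⟪flatVec L β q, ((β / 2) • stiffHessian L) (flatVec L β q)⟫ - β / 2 * wilsonAction su2Rep (orthoTube L 1 (flatMap L β q)))) := by
  unfold cK mehlerKernel
  have hdiff : linkEmbed L (flatMap L β p - flatMap L β q) - (gaugeModes L).starProjection (linkEmbed L (flatMap L β p - flatMap L β q)) =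
      ∑ i : StiffIdx L β, (flatScale L β i * (p - q).1 i) • eigVec L β i.1 := by
    rw [map_sub, linkEmbed_flatMap, linkEmbed_flatMap, ← map_sub (flatVec L β), flatVec_sub_starProjection]
  rw [hdiff, norm_stiffPart_sq, inner_hessian_flatVec, inner_hessian_flatVec]
  rw [← Real.exp_add, ← Real.exp_add, ← Real.exp_add]
  congr 1
  have e1 : ∑ k, (flatA L β k * p.1 k ^ 2 + flatB L β k * (p.1 k - q.1 k) ^ 2 + flatA L β k * q.1 k ^ 2) =
      (∑ k, flatA L β k * p.1 k ^ 2) + (∑ k, flatB L β k * (p.1 k - q.1 k) ^ 2) + ∑ k, flatA L β k * q.1 k ^ 2 := by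
    rw [Finset.sum_add_distrib, Finset.sum_add_distrib]
  have e2 : β * ∑ i, (flatScale L β i * (p - q).1 i) ^ 2 = ∑ k, flatB L β k * (p.1 k - q.1 k) ^ 2 := by
    rw [Finset.mul_sum]; refine Finset.sum_congr rfl fun k _ => ?_; unfold flatB; simp only [Prod.fst_sub, Pi.sub_apply]; ring
  rw [e1, e2]; ring

/-- ★★ **The true kernel against the flat kernel on the ball** (given the action-to-Hessian bound `η` on `cS`):
`e^{−2η}·G/vacCoef² ≤ (cΘ·cK·cΘ)∘flatMap² ≤ e^{2η}·G/vacCoef²`, `G = hR0·K·hR0'·e^{−‖z‖²/s²}e^{−‖z'‖²/s²}`. [cite: Wipf2021, §8.5.1 (8.56)] -/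
theorem kernel_flatMap_two_sided {β : ℝ} (hβ : 0 < β) {η : ℝ}
    (hη : ∀ y ∈ cS L β, |β / 2 * wilsonAction su2Rep (orthoTube L 1 y) - ⟪linkEmbed L y, ((β / 2) • stiffHessian L) (linkEmbed L y)⟫| ≤ η)
    {p q : (StiffIdx L β → ℝ) × gaugeModes L} (hp : flatMap L β p ∈ cS L β) (hq : flatMap L β q ∈ cS L β) :
    Real.exp (-(2 * η)) * ((hR 0 p.1 * mehlerKernel (flatA L β) (flatB L β) p.1 q.1 * hR 0 q.1 *
        (Real.exp (-(‖(p.2 : LinkSpace L)‖ ^ 2 / powScale 1 β ^ 2)) * Real.exp (-(‖(q.2 : LinkSpace L)‖ ^ 2 / powScale 1 β ^ 2)))) / vacCoef (StiffIdx L β) ^ 2) ≤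
      cΘ L β (flatMap L β p) * cK L β (flatMap L β p) (flatMap L β q) * cΘ L β (flatMap L β q) ∧
    cΘ L β (flatMap L β p) * cK L β (flatMap L β p) (flatMap L β q) * cΘ L β (flatMap L β q) ≤
      Real.exp (2 * η) * ((hR 0 p.1 * mehlerKernel (flatA L β) (flatB L β) p.1 q.1 * hR 0 q.1 *
        (Real.exp (-(‖(p.2 : LinkSpace L)‖ ^ 2 / powScale 1 β ^ 2)) * Real.exp (-(‖(q.2 : LinkSpace L)‖ ^ 2 / powScale 1 β ^ 2)))) / vacCoef (StiffIdx L β) ^ 2) := by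
  rw [cΘ_flatMap hβ hp, cΘ_flatMap hβ hq, cK_flatMap]
  set ep := Real.exp (⟪flatVec L β p, ((β / 2) • stiffHessian L) (flatVec L β p)⟫ - β / 2 * wilsonAction su2Rep (orthoTube L 1 (flatMap L β p))) with hep
  set eq' := Real.exp (⟪flatVec L β q, ((β / 2) • stiffHessian L) (flatVec L β q)⟫ - β / 2 * wilsonAction su2Rep (orthoTube L 1 (flatMap L β q))) with heq
  set G := hR 0 p.1 * mehlerKernel (flatA L β) (flatB L β) p.1 q.1 * hR 0 q.1 *
      (Real.exp (-(‖(p.2 : LinkSpace L)‖ ^ 2 / powScale 1 β ^ 2)) * Real.exp (-(‖(q.2 : LinkSpace L)‖ ^ 2 / powScale 1 β ^ 2))) with hG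
  have hv0 := vacCoef_pos (σ := StiffIdx L β)
  have hG0 : 0 ≤ G := by
    rw [hG]; have := (Mehler.hR_zero_pos_le (σ := StiffIdx L β) p.1).1; have := (Mehler.hR_zero_pos_le (σ := StiffIdx L β) q.1).1
    have := Mehler.mehlerKernel_pos (flatA L β) (flatB L β) p.1 q.1; positivity
  -- the action-to-Hessian factors
  have hb : ∀ {r : (StiffIdx L β → ℝ) × gaugeModes L}, flatMap L β r ∈ cS L β →
      Real.exp (-η) ≤ Real.exp (⟪flatVec L β r, ((β / 2) • stiffHessian L) (flatVec L β r)⟫ - β / 2 * wilsonAction su2Rep (orthoTube L 1 (flatMap L β r))) ∧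
      Real.exp (⟪flatVec L β r, ((β / 2) • stiffHessian L) (flatVec L β r)⟫ - β / 2 * wilsonAction su2Rep (orthoTube L 1 (flatMap L β r))) ≤ Real.exp η := by
    intro r hr
    have h := abs_le.1 (hη _ hr)
    rw [linkEmbed_flatMap] at h
    exact ⟨Real.exp_le_exp.2 (by linarith [h.2]), Real.exp_le_exp.2 (by linarith [h.1])⟩
  obtain ⟨hp1, hp2⟩ := hb hp
  obtain ⟨hq1, hq2⟩ := hb hq
  have hid : Real.exp (-(‖(p.2 : LinkSpace L)‖ ^ 2 / powScale 1 β ^ 2)) * (hR 0 p.1 / vacCoef (StiffIdx L β)) *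
      (mehlerKernel (flatA L β) (flatB L β) p.1 q.1 * (ep * eq')) * (Real.exp (-(‖(q.2 : LinkSpace L)‖ ^ 2 / powScale 1 β ^ 2)) * (hR 0 q.1 / vacCoef (StiffIdx L β))) =
      (ep * eq') * (G / vacCoef (StiffIdx L β) ^ 2) := by rw [hG]; field_simp
  rw [hid]
  have h2η : Real.exp (-(2 * η)) = Real.exp (-η) * Real.exp (-η) := by rw [← Real.exp_add]; ring_nf
  have h2η' : Real.exp (2 * η) = Real.exp η * Real.exp η := by rw [← Real.exp_add]; ring_nf
  have hGv : 0 ≤ G / vacCoef (StiffIdx L β) ^ 2 := by positivity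
  constructor
  · rw [h2η]
    exact mul_le_mul_of_nonneg_right (mul_le_mul hp1 hq1 (Real.exp_pos _).le (Real.exp_pos _).le) hGv
  · rw [h2η']
    exact mul_le_mul_of_nonneg_right (mul_le_mul hp2 hq2 (Real.exp_pos _).le (Real.exp_pos _).le) hGv

end Summit.QuantumFields.YangMills.Theorems.FemtoTransferGap.TwoLattice.ConstTube

end
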